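import Literature.Computability.QuantumComplexity.AaronsonAmbainisThm23Semantics
import HarnessLib

/-!
# Aaronson–Ambainis 2014, Thm. 23 (machine half): the meaning of the counting formulas, II — consistency and free positions

Fourth machine-level file of the polynomial-time half of Thm. 23 (arXiv:0911.0996v3, p. 14).
With the atoms computed on coded inputs (`AaronsonAmbainisThm23Semantics.lean`), the consistency
formulas and the free-position count of `AaronsonAmbainisThm23Formulas.lean` are identified with the
mathematical notions of `OracleReadCounting.lean` on the reads of the guessed coin strings
(`AaronsonAmbainisMoments.rd`):

* `tRunO_fst_eq` (labels do not depend on phase and flag), **`mem_readsI_iff`** / `mem_rd_iff` — a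
  read of the walk on `c` is `(index of the query of an oracle round t, c t, fl)`;
* **`consAll_iff`** — `ConsAll fl σ R ↔ OracleReads.Cons ρ i L` for any list `L` of reads with
  the reads of the slots `σ` as members;
* `card_image_eq_card_firsts` (distinct values = first occurrences) and **`freeCnt_eq`** —
  `FreeCnt σ R = |freeIdx ρ L|`.

No named facts.

## References

* S. Aaronson, A. Ambainis, *The need for structure in quantum speedups*, Theory Comput. 10
  (2014), proof of Thm. 23 (arXiv:0911.0996v3, p. 14) [AaronsonAmbainis2014].
-/

noncomputable section

namespace Literature.Computability.QuantumComplexity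

namespace Thm23Machine

open _root_.Computability Polynomial Complexity Complexity.Brick Complexity.Plumb Cryptography ADH Finset OracleReads
open Complexity.PRelSigma Complexity.TTClosure Complexity.PPSharpP Complexity.ThresholdPP
open scoped Classical

attribute [-simp] Brick.nthF_zero Brick.sndPow_zero

/-! ### The reads of a walk, by rounds -/

section Reads

variable (F : QCircuitFamily cliffordT) (x : List Bool)

/-- **Labels of the total walk do not depend on phase and flag.** [folklore] -/
theorem tRunO_fst_eq {N : ℕ} (gs : List (QGate cliffordT N)) : ∀ (cs : List Bool) (w : QReg N) (φ : ℕ) (v : Bool),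
    (tRunO gs cs (w, φ, v)).1 = (tRunO gs cs (w, 0, true)).1 := by
  induction gs with
  | nil => intro cs w φ v; rfl
  | cons g gs ih =>
    intro cs w φ v
    simp only [tRunO]
    rcases hs : tStepO g (headBit cs) (w, φ, v) with ⟨w₁, φ₁, v₁⟩
    rcases hs' : tStepO g (headBit cs) (w, 0, true) with ⟨w₂, φ₂, v₂⟩
    have h1 : w₁ = lStepO g (headBit cs) w := by rw [← tStepO_fst g (headBit cs) w φ v, hs]
    have h2 : w₂ = lStepO g (headBit cs) w := by rw [← tStepO_fst g (headBit cs) w 0 true, hs']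
    rw [ih, h1, ← h2, ← ih cs.tail w₂ φ₂ v₂]

/-- The label before round `t + 1` of `g :: gs` is the label before round `t` of `gs` from the stepped label. [folklore] -/
theorem label_take_succ {N : ℕ} (g : QGate cliffordT N) (gs : List (QGate cliffordT N)) (cs : List Bool) (w : QReg N) (t : ℕ) :
    (tRunO ((g :: gs).take (t + 1)) cs (w, 0, true)).1 = (tRunO (gs.take t) cs.tail (lStepO g (headBit cs) w, 0, true)).1 := by
  rw [List.take_succ_cons]
  simp only [tRunO]
  rcases hs : tStepO g (headBit cs) (w, 0, true) with ⟨w₁, φ₁, v₁⟩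
  have h1 : w₁ = lStepO g (headBit cs) w := by rw [← tStepO_fst g (headBit cs) w 0 true, hs]
  rw [tRunO_fst_eq, h1]

/-- **The reads of a walk, by rounds**: `r ∈ readsI gs cs w` iff for some oracle round `t`,
`r = (index of the query at the label before round t, coin t)`. [cite: AaronsonAmbainis2014, proof of Thm. 23 (p. 14)] -/
theorem mem_readsI_iff (r : Fin (numOracleBits F x) × Bool) :
    ∀ (gs : List (QGate cliffordT (oracleWidth F x))) (cs : List Bool) (w : QReg (oracleWidth F x)),
      r ∈ readsI F x gs cs w ↔ ∃ (t : ℕ) (ht : t < gs.length) (k : ℕ) (e : Fin (k + 1) ↪ Fin (oracleWidth F x)),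
        gs[t] = .oracle k e ∧
        r = (bitEquiv F x ⟨queryOf e (tRunO (gs.take t) cs (w, 0, true)).1, mem_shortStrings.2 (length_queryOf_lt e _)⟩, cs.getD t false)
  | [], cs, w => by simp [readsI]
  | .gate op e :: gs, cs, w => by
    rw [readsI, mem_readsI_iff r gs cs.tail _]
    constructor
    · rintro ⟨t, ht, k, e', hg, rfl⟩
      refine ⟨t + 1, by simpa using ht, k, e', by simpa using hg, ?_⟩
      simp only [label_take_succ, getD_tail]
    · rintro ⟨t, ht, k, e', hg, rfl⟩
      cases t with
      | zero => simp at hg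
      | succ t =>
        refine ⟨t, by simpa using ht, k, e', by simpa using hg, ?_⟩
        simp only [label_take_succ, getD_tail]
  | .oracle k₀ e₀ :: gs, cs, w => by
    rw [readsI, List.mem_cons, mem_readsI_iff r gs cs.tail _]
    constructor
    · rintro (rfl | ⟨t, ht, k, e', hg, rfl⟩)
      · refine ⟨0, by simp, k₀, e₀, by simp, ?_⟩
        simp [tRunO, headBit_eq_getD]
      · refine ⟨t + 1, by simpa using ht, k, e', by simpa using hg, ?_⟩
        simp only [label_take_succ, getD_tail]
    · rintro ⟨t, ht, k, e', hg, rfl⟩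
      cases t with
      | zero =>
        left
        simp only [List.getElem_cons_zero, QGate.oracle.injEq] at hg
        obtain ⟨rfl, he⟩ := hg
        subst he
        simp [tRunO, headBit_eq_getD]
      | succ t =>
        right
        refine ⟨t, by simpa using ht, k, e', by simpa using hg, ?_⟩
        simp only [label_take_succ, getD_tail]

/-- The read of slot coins `c` at an oracle round `t` (gate `(k, e)`), tagged `fl`. [folklore] -/
def readAt (c : Fin (gts F x).length → Bool) (fl : Bool) (t : ℕ) (ht : t < (gts F x).length) {k : ℕ}
    (e : Fin (k + 1) ↪ Fin (oracleWidth F x)) : Fin (numOracleBits F x) × Bool × Bool :=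
  (bitEquiv F x ⟨queryOf e (labAt F x (List.ofFn c) t), mem_shortStrings.2 (length_queryOf_lt e _)⟩, c ⟨t, ht⟩, fl)

/-- **Membership in `rd`**: the tagged reads of `c` are the `readAt c fl t` of the oracle rounds `t`. [folklore] -/
theorem mem_rd_iff (c : Fin (gts F x).length → Bool) (fl : Bool) (r : Fin (numOracleBits F x) × Bool × Bool) :
    r ∈ rd F x c fl ↔ ∃ (t : ℕ) (ht : t < (gts F x).length) (k : ℕ) (e : Fin (k + 1) ↪ Fin (oracleWidth F x)),
      (gts F x)[t] = .oracle k e ∧ r = readAt F x c fl t ht e := by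
  unfold rd readAt
  rw [List.mem_map]
  constructor
  · rintro ⟨r', hr', rfl⟩
    obtain ⟨t, ht, k, e, hg, rfl⟩ := (mem_readsI_iff F x r' _ _ _).1 hr'
    refine ⟨t, ht, k, e, hg, ?_⟩
    simp only [labAt, Prod.mk.injEq, and_true]
    exact ⟨rfl, by simp [ht]⟩
  · rintro ⟨t, ht, k, e, hg, rfl⟩
    refine ⟨(bitEquiv F x ⟨queryOf e (labAt F x (List.ofFn c) t), mem_shortStrings.2 (length_queryOf_lt e _)⟩, c ⟨t, ht⟩), ?_, rfl⟩
    rw [mem_readsI_iff]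
    refine ⟨t, ht, k, e, hg, ?_⟩
    simp only [labAt, Prod.mk.injEq]
    exact ⟨rfl, by simp [ht]⟩

/-- The index of a read as a number is the `PIdx` atom. [folklore] -/
theorem pIdx_eq_readAt (v : ℕ) {t : ℕ} (ht : t < (gts F x).length) {k : ℕ} {e : Fin (k + 1) ↪ Fin (oracleWidth F x)}
    (hg : (gts F x)[t] = .oracle k e) (fl : Bool) :
    PIdx F x (encodeNat v) t = ((readAt F x (digits (gts F x).length v) fl t ht e).1 : ℕ) := by
  rw [pIdx_eq F x v ht hg]; rfl

/-- The value of a read is the `PVal` atom. [folklore] -/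
theorem pVal_iff_readAt (v : ℕ) {t : ℕ} (ht : t < (gts F x).length) {k : ℕ} (e : Fin (k + 1) ↪ Fin (oracleWidth F x)) (fl : Bool) :
    PVal F x (encodeNat v) t ↔ (readAt F x (digits (gts F x).length v) fl t ht e).2.1 = true :=
  pVal_iff F x v ht

end Reads

/-! ### Consistency -/

section ConsSem

variable (F : QCircuitFamily cliffordT) (x : List Bool)
variable (ρ : List (Fin (numOracleBits F x) × Bool)) (i : Fin (numOracleBits F x))
variable {R : List Bool} (hx : xR R = x) (hd : dR R = F.descFn x) (hρ : rhoR R = encRho ρ) (hi : iR R = encodeNat i)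
variable {v : ℕ → ℕ} (hc : ∀ s < 4, coinR s R = encodeNat (v s))

/-- A list of reads CARRIES the slots `σ` with flips `fl` if its members are exactly the reads of
the slots' walks. [folklore] -/
def Carries (fl : Bool) (σ : List ℕ) (v : ℕ → ℕ) (L : List (Fin (numOracleBits F x) × Bool × Bool)) : Prop :=
  ∀ r, r ∈ L ↔ ∃ s ∈ σ, r ∈ rd F x (digits (gts F x).length (v s)) (flS fl s)

include hx hd hρ hi hc

omit hi in
/-- **`Cons1 s`** on a coded record: every read of slot `s` at an overridden position guesses
the prescribed bit. [cite: AaronsonAmbainis2014, proof of Thm. 23 (p. 14)] -/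
theorem cons1_iff {s : ℕ} (hs : s < 4) (fl : Bool) :
    Cons1 F s R ↔ ∀ r ∈ rd F x (digits (gts F x).length (v s)) (flS fl s), ∀ b, firstVal ρ r.1 = some b → r.2.1 = b := by
  have hμ := (mu_le_length F x hd).1
  have hρlen : ρ.length ≤ (rhoR R).length := by rw [hρ]; exact length_le_length_encRho ρ
  unfold Cons1
  rw [hx, hρ, hc s hs]
  constructor
  · intro H r hr b hb
    obtain ⟨t, ht, k, e, hg, rfl⟩ := (mem_rd_iff F x _ _ r).1 hr
    obtain ⟨m, hm, hfirst, hbit⟩ := exists_first_encRho_of_firstVal ρ hb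
    have h := H t (ht.trans_le hμ) ((pRead_iff F x _ t).2 ⟨ht, k, e, hg⟩) m (hm.trans_le (hρ ▸ hρlen))
      (by rw [pIdx_eq_readAt F x (v s) ht hg (flS fl s)]; exact hfirst)
    rw [pVal_iff_readAt F x (v s) ht e (flS fl s), rBit_encRho_iff ρ hm, hbit] at h
    simpa using h
  · intro H t _ hread m _ hfirst
    obtain ⟨ht, k, e, hg⟩ := (pRead_iff F x _ t).1 hread
    rw [pIdx_eq_readAt F x (v s) ht hg (flS fl s)] at hfirst
    obtain ⟨hm, hj, hfv⟩ := firstVal_of_first_encRho ρ hfirst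
    have h := H _ ((mem_rd_iff F x _ _ _).2 ⟨t, ht, k, e, hg, rfl⟩) _ hfv
    rw [pVal_iff_readAt F x (v s) ht e (flS fl s), rBit_encRho_iff ρ hm, h]

omit hd hρ in
/-- **`forcedB`** on a coded record is `forcedVal` of the read. [folklore] -/
theorem forcedB_eq {s : ℕ} (hs : s < 4) (fl : Bool) {t : ℕ} (ht : t < (gts F x).length) {k : ℕ}
    {e : Fin (k + 1) ↪ Fin (oracleWidth F x)} (hg : (gts F x)[t] = .oracle k e) :
    forcedB F fl s R t = forcedVal i (readAt F x (digits (gts F x).length (v s)) (flS fl s) t ht e) := by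
  unfold forcedB forcedVal
  rw [hx, hc s hs, hi, bitsToNat_encodeNat, pIdx_eq_readAt F x (v s) ht hg (flS fl s)]
  have hv := pVal_iff_readAt F x (v s) ht e (flS fl s)
  have hdec : decide (PVal F x (encodeNat (v s)) t) = (readAt F x (digits (gts F x).length (v s)) (flS fl s) t ht e).2.1 := by
    cases hb : (readAt F x (digits (gts F x).length (v s)) (flS fl s) t ht e).2.1
    · rw [hb] at hv
      simp only [Bool.false_eq_true, iff_false] at hv; exact decide_eq_false hv
    · rw [hb] at hv
      simp only [iff_true] at hv; exact decide_eq_true hv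
  rw [hdec]
  simp only [readAt, Fin.ext_iff]
  rfl

omit hd hi in
/-- `Free` on the coded list at the index of a read. [folklore] -/
theorem free_pIdx_iff {s : ℕ} (hs : s < 4) (fl : Bool) {t : ℕ} (ht : t < (gts F x).length) {k : ℕ}
    {e : Fin (k + 1) ↪ Fin (oracleWidth F x)} (hg : (gts F x)[t] = .oracle k e) :
    Free (rhoR R) (PIdx F (xR R) (coinR s R) t) ↔ firstVal ρ (readAt F x (digits (gts F x).length (v s)) (flS fl s) t ht e).1 = none := by
  rw [hρ, hx, hc s hs, pIdx_eq_readAt F x (v s) ht hg (flS fl s), free_encRho_fin_iff]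

/-- **`Cons2 s s'`** on a coded record: free reads of the two slots at the same position force the
same bit. [cite: AaronsonAmbainis2014, proof of Thm. 23 (p. 14)] -/
theorem cons2_iff {s s' : ℕ} (hs : s < 4) (hs' : s' < 4) (fl : Bool) :
    Cons2 F fl s s' R ↔ ∀ r ∈ rd F x (digits (gts F x).length (v s)) (flS fl s), ∀ r' ∈ rd F x (digits (gts F x).length (v s')) (flS fl s'),
      firstVal ρ r.1 = none → r.1 = r'.1 → forcedVal i r = forcedVal i r' := by
  have hμ := (mu_le_length F x hd).1
  unfold Cons2
  constructor
  · intro H r hr r' hr' hfree heq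
    obtain ⟨t, ht, k, e, hg, rfl⟩ := (mem_rd_iff F x _ _ r).1 hr
    obtain ⟨t', ht', k', e', hg', rfl⟩ := (mem_rd_iff F x _ _ r').1 hr'
    have h := H t (ht.trans_le hμ) t' (ht'.trans_le hμ) (by rw [hx, hc s hs]; exact (pRead_iff F x _ t).2 ⟨ht, k, e, hg⟩)
      (by rw [hx, hc s' hs']; exact (pRead_iff F x _ t').2 ⟨ht', k', e', hg'⟩)
      ((free_pIdx_iff F x ρ hx hρ hc hs fl ht hg).2 hfree)
      (by rw [hx, hc s hs, hc s' hs', pIdx_eq_readAt F x (v s) ht hg (flS fl s), pIdx_eq_readAt F x (v s') ht' hg' (flS fl s'), heq])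
    rwa [forcedB_eq F x i hx hi hc hs fl ht hg, forcedB_eq F x i hx hi hc hs' fl ht' hg'] at h
  · intro H t _ t' _ hread hread' hfree heq
    rw [hx, hc s hs] at hread
    rw [hx, hc s' hs'] at hread'
    obtain ⟨ht, k, e, hg⟩ := (pRead_iff F x _ t).1 hread
    obtain ⟨ht', k', e', hg'⟩ := (pRead_iff F x _ t').1 hread'
    rw [free_pIdx_iff F x ρ hx hρ hc hs fl ht hg] at hfree
    rw [hx, hc s hs, hc s' hs', pIdx_eq_readAt F x (v s) ht hg (flS fl s), pIdx_eq_readAt F x (v s') ht' hg' (flS fl s')] at heq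
    rw [forcedB_eq F x i hx hi hc hs fl ht hg, forcedB_eq F x i hx hi hc hs' fl ht' hg']
    exact H _ ((mem_rd_iff F x _ _ _).2 ⟨t, ht, k, e, hg, rfl⟩) _ ((mem_rd_iff F x _ _ _).2 ⟨t', ht', k', e', hg', rfl⟩)
      hfree (Fin.ext heq)

/-- **`ConsAll fl σ`** on a coded record is `OracleReads.Cons ρ i` of any list carrying the reads
of the slots `σ`. [cite: AaronsonAmbainis2014, proof of Thm. 23 (p. 14)] -/
theorem consAll_iff {fl : Bool} {σ : List ℕ} (hσ : ∀ s ∈ σ, s < 4) {L : List (Fin (numOracleBits F x) × Bool × Bool)}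
    (hL : Carries F x fl σ v L) : ConsAll F fl σ R ↔ Cons ρ i L := by
  unfold ConsAll Cons
  constructor
  · rintro ⟨H1, H2⟩
    refine ⟨fun r hr b hb => ?_, fun r hr r' hr' hfree heq => ?_⟩
    · obtain ⟨s, hs, hr⟩ := (hL r).1 hr
      exact ((cons1_iff F x ρ hx hd hρ hc (hσ s hs) fl).1 (H1 s hs)) r hr b hb
    · obtain ⟨s, hs, hr⟩ := (hL r).1 hr
      obtain ⟨s', hs', hr'⟩ := (hL r').1 hr'
      exact ((cons2_iff F x ρ i hx hd hρ hi hc (hσ s hs) (hσ s' hs') fl).1 (H2 s hs s' hs')) r hr r' hr' hfree heq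
  · rintro ⟨H1, H2⟩
    refine ⟨fun s hs => (cons1_iff F x ρ hx hd hρ hc (hσ s hs) fl).2 fun r hr b hb => H1 r ((hL r).2 ⟨s, hs, hr⟩) b hb,
      fun s hs s' hs' => (cons2_iff F x ρ i hx hd hρ hi hc (hσ s hs) (hσ s' hs') fl).2 fun r hr r' hr' hfree heq =>
        H2 r ((hL r).2 ⟨s, hs, hr⟩) r' ((hL r').2 ⟨s', hs', hr'⟩) hfree heq⟩

end ConsSem

/-! ### Distinct values and first occurrences -/

section Firsts

/-- **The number of distinct values of `f` on `S` is the number of first occurrences** (elements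
of `S` whose value is not taken at a smaller element). [folklore] -/
theorem card_image_eq_card_firsts {β : Type*} [DecidableEq β] (S : Finset ℕ) (f : ℕ → β) :
    (S.image f).card = (S.filter fun a => ∀ a' ∈ S, a' < a → f a' ≠ f a).card := by
  symm
  refine Finset.card_bij (fun a _ => f a) (fun a ha => Finset.mem_image_of_mem f (Finset.mem_filter.1 ha).1) ?_ ?_
  · intro a₁ ha₁ a₂ ha₂ h
    obtain ⟨h1, hf1⟩ := Finset.mem_filter.1 ha₁
    obtain ⟨h2, hf2⟩ := Finset.mem_filter.1 ha₂
    rcases lt_trichotomy a₁ a₂ with hlt | heq | hgt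
    · exact absurd h (hf2 a₁ h1 hlt)
    · exact heq
    · exact absurd h.symm (hf1 a₂ h2 hgt)
  · intro b hb
    obtain ⟨a, ha, rfl⟩ := Finset.mem_image.1 hb
    let T := S.filter fun a' => f a' = f a
    have hT : T.Nonempty := ⟨a, Finset.mem_filter.2 ⟨ha, rfl⟩⟩
    refine ⟨T.min' hT, Finset.mem_filter.2 ⟨(Finset.mem_filter.1 (Finset.min'_mem T hT)).1, fun a' ha' hlt heq => ?_⟩,
      (Finset.mem_filter.1 (Finset.min'_mem T hT)).2⟩
    have : a' ∈ T := Finset.mem_filter.2 ⟨ha', heq.trans (Finset.mem_filter.1 (Finset.min'_mem T hT)).2⟩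
    exact absurd (Finset.min'_le T a' this) (not_le.2 hlt)

/-- **Block decomposition**: summing, over the slots `s ∈ σ ⊆ {0,1,2,3}`, the number of `t < B` with
`Q s t` counts the numbers `p < 4B` with `p / B ∈ σ` and `Q (p / B) (p mod B)`. [folklore] -/
theorem sum_card_filter_eq_card_blocks {B : ℕ} (hB : 0 < B) (Q : ℕ → ℕ → Prop) {σ : List ℕ} (hσ : ∀ s ∈ σ, s < 4) (hnd : σ.Nodup) :
    (σ.map fun s => ((range B).filter (Q s)).card).sum = ((range (4 * B)).filter fun p => p / B ∈ σ ∧ Q (p / B) (p % B)).card := by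
  rw [Finset.card_eq_sum_card_fiberwise (f := fun p => p / B) (t := range 4) (fun p hp => by
    simp only [Finset.mem_coe, Finset.mem_filter, Finset.mem_range] at hp ⊢
    exact Nat.div_lt_of_lt_mul (by linarith [hp.1]))]
  have hfiber : ∀ s ∈ range 4, (((range (4 * B)).filter fun p => p / B ∈ σ ∧ Q (p / B) (p % B)).filter fun p => p / B = s).card =
      if s ∈ σ then ((range B).filter (Q s)).card else 0 := by
    intro s hs4
    rw [Finset.mem_range] at hs4
    split_ifs with hs
    · symm
      refine Finset.card_bij (fun t _ => s * B + t) ?_ ?_ ?_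
      · intro t ht
        obtain ⟨htB, hq⟩ := Finset.mem_filter.1 ht
        rw [Finset.mem_range] at htB
        have hdiv : (s * B + t) / B = s := by rw [Nat.add_comm, Nat.add_mul_div_right _ _ hB, Nat.div_eq_of_lt htB, zero_add]
        have hmod : (s * B + t) % B = t := by rw [Nat.add_comm, Nat.add_mul_mod_self_right, Nat.mod_eq_of_lt htB]
        refine Finset.mem_filter.2 ⟨Finset.mem_filter.2 ⟨Finset.mem_range.2 (by nlinarith), ?_, ?_⟩, hdiv⟩
        · rw [hdiv]; exact hs
        · rw [hdiv, hmod]; exact hq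
      · intro t₁ _ t₂ _ h; exact Nat.add_left_cancel h
      · intro p hp
        simp only [Finset.mem_filter, Finset.mem_range] at hp
        obtain ⟨⟨-, -, hq⟩, hps⟩ := hp
        refine ⟨p % B, Finset.mem_filter.2 ⟨Finset.mem_range.2 (Nat.mod_lt _ hB), hps ▸ hq⟩, ?_⟩
        conv_rhs => rw [← Nat.div_add_mod p B, hps]
        ring
    · rw [Finset.card_eq_zero, Finset.filter_eq_empty_iff]
      intro p hp hps
      rw [Finset.mem_filter] at hp
      exact hs (hps ▸ hp.2.1)
  rw [Finset.sum_congr rfl hfiber, ← Finset.sum_filter]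
  have hset : ((range 4).filter fun s => s ∈ σ) = σ.toFinset := by
    ext s; simp only [Finset.mem_filter, Finset.mem_range, List.mem_toFinset]
    exact ⟨fun h => h.2, fun h => ⟨hσ s h, h⟩⟩
  rw [hset, List.sum_toFinset _ hnd]

end Firsts

/-! ### The free-position count -/

section FreeSem

variable (F : QCircuitFamily cliffordT) (x : List Bool)
variable (ρ : List (Fin (numOracleBits F x) × Bool)) (i : Fin (numOracleBits F x))
variable {R : List Bool} (hx : xR R = x) (hd : dR R = F.descFn x) (hρ : rhoR R = encRho ρ)
variable {v : ℕ → ℕ} (hc : ∀ s < 4, coinR s R = encodeNat (v s))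
include hx hd hρ hc

omit hd hρ in
/-- `NewFree` forces an oracle round. [folklore] -/
theorem newFree_lt {σ : List ℕ} {s : ℕ} (hs : s < 4) {t : ℕ} (h : NewFree F σ s R t) : t < (gts F x).length := by
  obtain ⟨hread, -⟩ := h
  rw [hx, hc s hs] at hread
  exact ((pRead_iff F x _ t).1 hread).1

omit hρ in
/-- The count of `FreeCnt`, per slot, over the rounds `t < μ`. [folklore] -/
theorem freeCnt_eq_sum {σ : List ℕ} (hσ : ∀ s ∈ σ, s < 4) :
    FreeCnt F σ R = (σ.map fun s => ((range (gts F x).length).filter fun t => NewFree F σ s R t).card).sum := by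
  unfold FreeCnt
  congr 1
  refine List.map_congr_left fun s hs => ?_
  congr 1
  ext t
  simp only [Finset.mem_filter, Finset.mem_range, eval_X]
  have hμ := mu_le_length F x hd
  constructor
  · rintro ⟨-, -, h⟩; exact ⟨newFree_lt F x hx hc (hσ s hs) h, h⟩
  · rintro ⟨ht, h⟩
    exact ⟨ht.trans_le (hμ.1.trans (hμ.2.trans Nat.lt_two_pow_self.le)), ht.trans_le hμ.1, h⟩

/-- The set of free reads, coded as `p = s·μ + t`. [folklore] -/
def freeReads (σ : List ℕ) (R : List Bool) : Finset ℕ :=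
  (range (4 * (gts F x).length)).filter fun p =>
    p / (gts F x).length ∈ σ ∧ PRead F (xR R) (coinR (p / (gts F x).length) R) (p % (gts F x).length) ∧
      Free (rhoR R) (PIdx F (xR R) (coinR (p / (gts F x).length) R) (p % (gts F x).length))

omit hρ in
/-- **`NewFree` is membership in the free reads plus first occurrence of the index.** [folklore] -/
theorem newFree_iff_first {σ : List ℕ} (hσ : ∀ s ∈ σ, s < 4) (hμ : 0 < (gts F x).length) {p : ℕ} (hp : p < 4 * (gts F x).length) :
    (p / (gts F x).length ∈ σ ∧ NewFree F σ (p / (gts F x).length) R (p % (gts F x).length)) ↔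
      p ∈ freeReads F x σ R ∧ ∀ p' ∈ freeReads F x σ R, p' < p →
        PIdx F (xR R) (coinR (p' / (gts F x).length) R) (p' % (gts F x).length) ≠ PIdx F (xR R) (coinR (p / (gts F x).length) R) (p % (gts F x).length) := by
  set B := (gts F x).length with hB
  have hdlen := (mu_le_length F x hd).1
  constructor
  · rintro ⟨hsσ, hread, hfree, hslots, hrounds⟩
    refine ⟨Finset.mem_filter.2 ⟨Finset.mem_range.2 hp, hsσ, hread, hfree⟩, fun p' hp' hlt => ?_⟩
    obtain ⟨-, hs'σ, hread', -⟩ := Finset.mem_filter.1 hp'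
    have ht' : p' % B < B := Nat.mod_lt _ hμ
    -- `p' < p` in the block order
    rcases Nat.lt_or_ge (p' / B) (p / B) with hs | hs
    · exact hslots _ hs'σ hs _ (ht'.trans_le hdlen) hread'
    · have hseq : p' / B = p / B := le_antisymm (Nat.div_le_div_right hlt.le) hs
      have htlt : p' % B < p % B := by
        have h1 := Nat.div_add_mod p' B
        have h2 := Nat.div_add_mod p B
        rw [hseq] at h1
        omega
      rw [hseq] at hread' ⊢
      exact hrounds _ htlt hread'
  · rintro ⟨hmem, hfirst⟩
    obtain ⟨-, hsσ, hread, hfree⟩ := Finset.mem_filter.1 hmem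
    refine ⟨hsσ, hread, hfree, fun s' hs'σ hs' t' _ hread' heq => ?_, fun t' ht' hread' heq => ?_⟩
    · -- the earlier read `(s', t')` has the same index, hence is free too, hence in `freeReads`
      have ht'B : t' < B := by rw [hx, hc s' (hσ s' hs'σ)] at hread'; exact ((pRead_iff F x _ t').1 hread').1
      have hdiv : (s' * B + t') / B = s' := by rw [Nat.add_comm, Nat.add_mul_div_right _ _ hμ, Nat.div_eq_of_lt ht'B, zero_add]
      have hmod : (s' * B + t') % B = t' := by rw [Nat.add_comm, Nat.add_mul_mod_self_right, Nat.mod_eq_of_lt ht'B]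
      have hmem' : s' * B + t' ∈ freeReads F x σ R := by
        refine Finset.mem_filter.2 ⟨Finset.mem_range.2 (by nlinarith [hσ s' hs'σ]), ?_, ?_, ?_⟩
        · rw [hdiv]; exact hs'σ
        · rw [hdiv, hmod]; exact hread'
        · rw [hdiv, hmod, heq]; exact hfree
      have hlt : s' * B + t' < p := by
        have h3 : (s' + 1) * B ≤ p / B * B := Nat.mul_le_mul_right _ hs'
        have h4 : p / B * B ≤ p := Nat.div_mul_le_self p B
        have h5 : (s' + 1) * B = s' * B + B := by ring
        omega
      have := hfirst _ hmem' hlt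
      rw [hdiv, hmod] at this
      exact this heq
    · have ht'B : t' < B := ht'.trans (Nat.mod_lt _ hμ)
      have hdiv : (p / B * B + t') / B = p / B := by rw [Nat.add_comm, Nat.add_mul_div_right _ _ hμ, Nat.div_eq_of_lt ht'B, zero_add]
      have hmod : (p / B * B + t') % B = t' := by rw [Nat.add_comm, Nat.add_mul_mod_self_right, Nat.mod_eq_of_lt ht'B]
      have hmem' : p / B * B + t' ∈ freeReads F x σ R := by
        refine Finset.mem_filter.2 ⟨Finset.mem_range.2 ?_, ?_, ?_, ?_⟩
        · have : p / B < 4 := Nat.div_lt_of_lt_mul (by linarith); nlinarith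
        · rw [hdiv]; exact hsσ
        · rw [hdiv, hmod]; exact hread'
        · rw [hdiv, hmod, heq]; exact hfree
      have hlt : p / B * B + t' < p := by have h2 := Nat.div_add_mod p B; rw [Nat.mul_comm] at h2; omega
      have := hfirst _ hmem' hlt
      rw [hdiv, hmod] at this
      exact this heq

omit hd in
/-- **The free reads project onto the free positions**: the index numbers of `freeReads` are the
values of `freeIdx ρ L`. [folklore] -/
theorem image_freeReads {fl : Bool} {σ : List ℕ} (hσ : ∀ s ∈ σ, s < 4) (hμ : 0 < (gts F x).length)
    {L : List (Fin (numOracleBits F x) × Bool × Bool)} (hL : Carries F x fl σ v L) :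
    (freeReads F x σ R).image (fun p => PIdx F (xR R) (coinR (p / (gts F x).length) R) (p % (gts F x).length)) =
      (freeIdx ρ L).map Fin.valEmbedding := by
  set B := (gts F x).length with hB
  ext j
  constructor
  · intro hj
    obtain ⟨p, hp, rfl⟩ := Finset.mem_image.1 hj
    obtain ⟨-, hsσ, hread, hfree⟩ := Finset.mem_filter.1 hp
    have hs4 := hσ _ hsσ
    rw [hx, hc _ hs4] at hread
    obtain ⟨ht, k, e, hg⟩ := (pRead_iff F x _ _).1 hread
    rw [free_pIdx_iff F x ρ hx hρ hc hs4 fl ht hg] at hfree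
    refine Finset.mem_map.2 ⟨(readAt F x (digits B (v (p / B))) (flS fl (p / B)) (p % B) ht e).1,
      mem_freeIdx.2 ⟨_, (hL _).2 ⟨_, hsσ, (mem_rd_iff F x _ _ _).2 ⟨_, ht, k, e, hg, rfl⟩⟩, hfree, rfl⟩, ?_⟩
    rw [Fin.valEmbedding_apply, hx, hc _ hs4, pIdx_eq_readAt F x _ ht hg (flS fl (p / B))]
  · intro hj
    obtain ⟨j', hj', rfl⟩ := Finset.mem_map.1 hj
    obtain ⟨r, hr, hfree, rfl⟩ := mem_freeIdx.1 hj'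
    obtain ⟨s, hsσ, hr⟩ := (hL r).1 hr
    have hs4 := hσ s hsσ
    obtain ⟨t, ht, k, e, hg, rfl⟩ := (mem_rd_iff F x _ _ r).1 hr
    have hdiv : (s * B + t) / B = s := by rw [Nat.add_comm, Nat.add_mul_div_right _ _ hμ, Nat.div_eq_of_lt ht, zero_add]
    have hmod : (s * B + t) % B = t := by rw [Nat.add_comm, Nat.add_mul_mod_self_right, Nat.mod_eq_of_lt ht]
    refine Finset.mem_image.2 ⟨s * B + t, Finset.mem_filter.2 ⟨Finset.mem_range.2 (by nlinarith), ?_, ?_, ?_⟩, ?_⟩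
    · rw [hdiv]; exact hsσ
    · rw [hdiv, hmod, hx, hc s hs4]; exact (pRead_iff F x _ t).2 ⟨ht, k, e, hg⟩
    · rw [hdiv, hmod, free_pIdx_iff F x ρ hx hρ hc hs4 fl ht hg]; exact hfree
    · rw [hdiv, hmod, hx, hc s hs4, pIdx_eq_readAt F x (v s) ht hg (flS fl s), Fin.valEmbedding_apply]

/-- **`FreeCnt σ R = |freeIdx ρ L|`**: the formula counts the distinct free positions read.
[cite: AaronsonAmbainis2014, proof of Thm. 23 (p. 14)] -/
theorem freeCnt_eq {fl : Bool} {σ : List ℕ} (hσ : ∀ s ∈ σ, s < 4) (hnd : σ.Nodup)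
    {L : List (Fin (numOracleBits F x) × Bool × Bool)} (hL : Carries F x fl σ v L) :
    FreeCnt F σ R = (freeIdx ρ L).card := by
  set B := (gts F x).length with hB
  rcases Nat.eq_zero_or_pos B with hμ | hμ
  · -- no gates: no reads at all
    rw [freeCnt_eq_sum F x hx hd hc hσ]
    have h0 : ∀ s ∈ σ, ((range B).filter fun t => NewFree F σ s R t).card = 0 := fun s _ => by rw [hμ]; simp
    rw [List.map_congr_left h0, List.map_const', List.sum_replicate, smul_zero]
    symm
    rw [Finset.card_eq_zero, Finset.eq_empty_iff_forall_notMem]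
    intro j hj
    obtain ⟨r, hr, -, -⟩ := mem_freeIdx.1 hj
    obtain ⟨s, -, hr⟩ := (hL r).1 hr
    obtain ⟨t, ht, -⟩ := (mem_rd_iff F x _ _ r).1 hr
    rw [← hB, hμ] at ht
    exact absurd ht (Nat.not_lt_zero _)
  · rw [freeCnt_eq_sum F x hx hd hc hσ,
      sum_card_filter_eq_card_blocks hμ (fun s t => NewFree F σ s R t) hσ hnd]
    have hfirst : ((range (4 * B)).filter fun p => p / B ∈ σ ∧ NewFree F σ (p / B) R (p % B)) =
        (freeReads F x σ R).filter fun p => ∀ p' ∈ freeReads F x σ R, p' < p →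
          PIdx F (xR R) (coinR (p' / B) R) (p' % B) ≠ PIdx F (xR R) (coinR (p / B) R) (p % B) := by
      ext p
      simp only [Finset.mem_filter, Finset.mem_range]
      constructor
      · rintro ⟨hp, h⟩
        exact ⟨((newFree_iff_first F x hx hd hc hσ hμ hp).1 h).1, ((newFree_iff_first F x hx hd hc hσ hμ hp).1 h).2⟩
      · rintro ⟨hmem, h⟩
        have hp : p < 4 * B := Finset.mem_range.1 (Finset.mem_filter.1 hmem).1
        exact ⟨hp, (newFree_iff_first F x hx hd hc hσ hμ hp).2 ⟨hmem, h⟩⟩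
    rw [hfirst, ← card_image_eq_card_firsts, image_freeReads F x ρ hx hρ hc hσ hμ hL, Finset.card_map]

end FreeSem

end Thm23Machine

end Literature.Computability.QuantumComplexity

end
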